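import Summits.QuantumFields.YangMills.Theorems.AlphaInputsT3ACv3StepTrivPinsBlockAvgKnit
import HarnessLib

/-!
# `AlphaInputsT3ACv3StepLowWeightedPins` — THE LOWER ROW (57)∕(47) FROM THE PINS WITH AN ABSTRACT SMALL-FIELD WEIGHT `w` IN THE FLUCTUATION INTEGRAND (the weight-generic
# edition of ✓`PinnedStepTrivPins.fibre57LowOnAC_of_localChart` ∕ ✓`fibre57LowOnAC_of_blockAvgChart`; cell `ym3-torus`, (α)-row #23 `fibre57LowOn`, the post-freeze (R7) slot∕cut docket;
# seat `ym3-torus-px20` g14 — DOOR 4, ★★OWNER g37 WORD №123 «(R7a)'s lower-pin typing road — GO as a HELPER»; `--supports stmt-QuantumFields-19936 --as helper`)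

WHY (w8-19936 g17 «χ-CLASH» 2026-08-30 16:43Z; ★★OWNER g37 RULINGS №50∕№123; w4-20520 g20 LOCATE v1.1 `LOCATE-hdom-E2-knockon.v1_1.w4g20.md`).  The tree's lower-row pins road hard-codes the
(4)-window factor `χB_k(triv′)` as the small-field weight of the fluctuation integrand (`hFl`∕`hpos` of ✓`fibre57LowOnAC_of_localChart`) and therefore displays the letter
`hdom : χB ≠ 0 → U ∈ lo k` — at print's family `loPrintAC` (constant 1) a letter with no supplier in print or tree, and one the registered pair {#22 (triv′), #23@loPrintAC} FORCES a.e.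
under the single `logFl` slot (χ-clash).  Print's lower bound (47) p.267 carries its OWN cut `χ_k` («the restrictions on V given by the conditions |U_k(∂p) − 1| < g_kp(g_k)η²»);
every repair on the post-freeze docket — (R7a) two fluctuation slots `logFl⁺`∕`logFl⁻`, (R7c) the (E1) family, (R7d) print's χ_k in the upper row too — types the LOWER pin with a
small-field weight OTHER than the bare `χB`.  THIS FILE re-types the pins road ONCE for an ABSTRACT weight `w : GaugeField → ℝ` — measurable, `0 ≤ w ≤ 1`, gauge invariant,
supported in the chart region and in `lo k` — so that `hdom` becomes the SUPPORT CONDITION `hwlo : w U ≠ 0 → U ∈ lo k` of the definer's own weight (DEFINITIONAL for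
`w = χB·𝟙[loPrintAC k]` = print's χ_k; today's road is `w = χB`, `hwlo = hdom`):
* §1 ★★ `fibre57LowOnAC_of_localChart_weight` — ✓`fibre57LowOnAC_of_localChart` VERBATIM with `χB ↦ w` in `hFl`∕`hpos` and {`hO`, `hdom`} ↦ {`hwm hw0 hw1 hwinv hwO hwlo`}
  (that proof uses of `χB` only measurability, `0 ≤ χB ≤ 1`, gauge invariance ✓`chiB_gaugeAct`, `{χB ≠ 0} ⊆ O`, `{χB ≠ 0} ⊆ lo k`).
* §2 ★★ `fibre57LowOnAC_of_blockAvgChart_weight` — ✓`fibre57LowOnAC_of_blockAvgChart` VERBATIM with the weight `w` supported in the (4)-window (`hwχ : w U ≠ 0 → χB_k(triv′)(U) ≠ 0`,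
  whence `{w ≠ 0} ⊆ O_ε` by ✓`loopSmall_of_chiB_triv_ne_zero`) and in `lo k`.
* §3 the canonical instance: `chiB_mul_indicator_props` — `w := χB_k(triv′)·𝟙[lo k]` is measurable, in `[0,1]`, gauge invariant (given `hloinv`), supported in `{χB ≠ 0}` and in `lo k`.
The T³ knits (`…_T3_of_le_gamma`, the charging road with charging set `O_ε ∩ {w ≠ 0}` — door 3's ★★★ set at `w = χB·𝟙[loPrintAC k]` — and doors 1–3) follow in the sequel file.

HONEST SCOPE.  [folklore] bookkeeping — two landed proofs re-run with an abstract weight; def-free; the weighted pins are HYPOTHESES (a (R7) pin of the B0 definer, never asserted); nothing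
of #22∕#23, of `hdom`, of (47)∕(57), the (α) data rows (0∕23), (O‴χₛ), `HistoryTailL` (19936), EX, LOWB∘ or `YM3TorusSU2` is proved (rung R3 = SU(2) YM₃ on T³, a RECORD rung: NOT d = 4,
NOT infinite volume, NOT a mass gap, NOT Clay; the Yang–Mills mass gap is NOT proved).  L-floor: none.
References: T. Bałaban, Commun. Math. Phys. **102** (1985) 255–275 [Balaban1985UV3] ((13)–(18) pp.259–260, (37) p.265, (47) p.267, (49)–(58) pp.268–270, p.272 L32–33);
**109** (1987) 249–301 [Balaban1987RG1] ((0.4) p.253).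
-/

set_option autoImplicit false

noncomputable section

namespace Summit.QuantumFields.YangMills.Theorems.PinnedStepTrivPins

open MeasureTheory Literature.MathematicalPhysics.QuantumFieldTheory.Balaban1983to89
open Literature.MathematicalPhysics.QuantumFieldTheory.Balaban1983to89.AveragingRT (rnTransport)
open Literature.MathematicalPhysics.QuantumFieldTheory.Balaban1983to89.GaugeField (GaugeInvariant gaugeAct)
open Literature.MathematicalPhysics.QuantumFieldTheory.Balaban1983to89.BlockAveraging (avgFun loopHol Idx)
open Literature.MathematicalPhysics.QuantumFieldTheory.Balaban1983to89.ExpMeanLog (expMeanLogSU)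
open Literature.MathematicalPhysics.QuantumFieldTheory.Balaban1985CMP102 Literature.MathematicalPhysics.QuantumFieldTheory.Balaban1985CMP102.Setting
open Summit.QuantumFields.Balaban3D.Carriers
open Summit.QuantumFields.Balaban3D.Proofs.Inputs (LaneConsts)
open Summit.QuantumFields.Balaban3D.Proofs.ScalesArithmetic (gk_pos)
open Summit.QuantumFields.Balaban3D.Proofs.TowerAC Summit.QuantumFields.Balaban3D.Proofs.StandardAC Summit.QuantumFields.Balaban3D.Proofs.InputsAC
open Summit.QuantumFields.Balaban3D.Proofs.Bound55Masses (chiB chiB_nonneg chiB_le_one measurable_chiB)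
open Summit.QuantumFields.Balaban3D.Proofs.GaussianNormalization (partZ normalized integral_exp_neg_mul_eq)
open Summit.QuantumFields.Balaban3D.Proofs (Bound55Std.measurable_actionEta)
open Summit.QuantumFields.YangMills.Theorems.PinnedStep (massP wtP Fibre55WinAC Fibre57LowOnAC)
open Summit.QuantumFields.YangMills.Theorems.BlockAvgEMLWeightedFibreChart (loopSmall_of_chiB_triv_ne_zero)
open scoped NNReal ENNReal

/-! ## §1 The lower row from a local weighted fibre chart, abstract small-field weight (any gauge group) -/

section Chart

variable {L : ℕ} (𝔎 : LaneConsts L) {S : Scales L} {G : Type} [GaugeGroup G] [MeasurableSpace G] [HaarData G] [RegularGaugeGroup G]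
  {Val : Type} [NormedAddCommGroup Val] [NormedSpace ℂ Val]
  (X : ExternalInputsAC S G) (𝔖 : ∀ k, StepSeries S G Val (nblkOf S 𝔎.carrier k) k)
  {Ω : Type} [MeasurableSpace Ω]

/-- ★★ **THE LOWER ROW `Fibre57LowOnAC` AT EVERY LEVEL, ANY GAUGE GROUP, ANY AVERAGING WITH A LOCAL WEIGHTED FIBRE CHART — ABSTRACT SMALL-FIELD WEIGHT `w`**:
✓`fibre57LowOnAC_of_localChart` VERBATIM except that the fluctuation integrand of the pins `hFl`∕`hpos` carries an abstract weight `w (Φ (V, ω))` in place of `χB_k(triv′)(Φ (V, ω))`,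
with `w` measurable, `0 ≤ w ≤ 1`, gauge invariant, supported in the chart region `O` (`hwO`) and in the validity family `lo k` (`hwlo` — the old `hdom`, now a support condition on the
definer's weight).  The chart identity is applied to the `w`-cut integrand and `T[w·e^{…}] ≤ T[𝟙_{lo k}·e^{…}]` is the a.e. monotonicity of the transport.
[cite: Balaban1985UV3, (37) p.265 + (47) p.267 + (55)–(58) pp.269–270 + p.272 L32–33] -/
theorem fibre57LowOnAC_of_localChart_weight (lo : (k : ℕ) → Set (GaugeField S.P k G)) (k : ℕ)
    (vol : Measure Ω) (Φ : GaugeField S.P (k + 1) G × Ω → GaugeField S.P k G) (J : GaugeField S.P (k + 1) G × Ω → ℝ) (hJ0 : ∀ z, 0 ≤ J z)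
    (N lσ dg : ℝ) (O : Set (GaugeField S.P k G))
    (w : GaugeField S.P k G → ℝ) (hwm : Measurable w) (hw0 : ∀ U, 0 ≤ w U) (hw1 : ∀ U, w U ≤ 1) (hwinv : GaugeInvariant w)
    (hwO : ∀ U : GaugeField S.P k G, w U ≠ 0 → U ∈ O)
    (hchart : ∀ (ρ : Density S.P k G) (C : ℝ), Measurable ρ → (∀ U, |ρ U| ≤ C) → GaugeInvariant ρ → (∀ U, U ∉ O → ρ U = 0) →
      rnTransport (X.av k).avg ρ =ᵐ[fieldMeasure S.P (k + 1) G] fun V =>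
        Real.exp ((lσ + dg * Real.log (S.gk k)) * N) * ∫ ω, J (V, ω) * ρ (Φ (V, ω)) ∂vol)
    (q : GaugeField S.P (k + 1) G → Ω → ℝ) (hqm : ∀ V, Measurable (q V)) (hZ : ∀ V, 0 < partZ vol (q V))
    (hU : Measurable (X.UkH k (Hist.triv S.P k))) (hPm : Measurable ((inputOfAC 𝔎 X 𝔖).Pint k (Hist.triv S.P k)))
    (cP : ℝ) (hPb : ∀ U, (inputOfAC 𝔎 X 𝔖).Pint k (Hist.triv S.P k) U ≤ cP)
    (hinv : GaugeInvariant (fun U : GaugeField S.P k G =>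
      Real.exp (-((towerOfAC 𝔎 X 𝔖).mainT k (Hist.triv S.P k) U) + (towerOfAC 𝔎 X 𝔖).Pint k (Hist.triv S.P k) U)))
    (hlom : MeasurableSet (lo k)) (hloinv : ∀ (u : GaugeTransf S.P k G) (U : GaugeField S.P k G), gaugeAct u U ∈ lo k ↔ U ∈ lo k)
    (hwlo : ∀ U : GaugeField S.P k G, w U ≠ 0 → U ∈ lo k)
    (hσ : (piecesAC 𝔎 X 𝔖 k).logσ₀ = lσ) (hdg : (piecesAC 𝔎 X 𝔖 k).dg = dg) (hstar : (piecesAC 𝔎 X 𝔖 k).starB (Hist.triv S.P (k + 1)) = N)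
    (hZU : ∀ V, (piecesAC 𝔎 X 𝔖 k).logZU (Hist.triv S.P (k + 1)) V = Real.log (partZ vol (q V)))
    (hFl : ∀ V, (piecesAC 𝔎 X 𝔖 k).logFl (Hist.triv S.P (k + 1)) V =
      Real.log (∫ ω, J (V, ω) * w (Φ (V, ω)) *
              Real.exp (-((towerOfAC 𝔎 X 𝔖).mainT k (Hist.triv S.P k) (Φ (V, ω)) - (towerOfAC 𝔎 X 𝔖).mainT (k + 1) (Hist.triv S.P (k + 1)) V)
                + ((towerOfAC 𝔎 X 𝔖).Pint k (Hist.triv S.P k) (Φ (V, ω)) - (piecesAC 𝔎 X 𝔖 k).Pold (Hist.triv S.P (k + 1)) V) + q V ω)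
            ∂(normalized vol (q V))))
    (hpos : ∀ V, V ∈ lo (k + 1) →
      0 < ∫ ω, J (V, ω) * w (Φ (V, ω)) *
              Real.exp (-((towerOfAC 𝔎 X 𝔖).mainT k (Hist.triv S.P k) (Φ (V, ω)) - (towerOfAC 𝔎 X 𝔖).mainT (k + 1) (Hist.triv S.P (k + 1)) V)
                + ((towerOfAC 𝔎 X 𝔖).Pint k (Hist.triv S.P k) (Φ (V, ω)) - (piecesAC 𝔎 X 𝔖 k).Pold (Hist.triv S.P (k + 1)) V) + q V ω)
            ∂(normalized vol (q V))) :
    Fibre57LowOnAC 𝔎 X 𝔖 lo k := by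
  classical
  set χ₀ : GaugeField S.P k G → ℝ := w with hχ₀
  set φ : GaugeField S.P k G → ℝ := (lo k).indicator (fun _ => (1 : ℝ)) with hφ
  set c : ℝ := -(towerOfAC 𝔎 X 𝔖).Ecst k - (towerOfAC 𝔎 X 𝔖).Rm k with hc
  have hφm : Measurable φ := measurable_const.indicator hlom
  have hφ0 : ∀ U, 0 ≤ φ U := fun U => Set.indicator_nonneg (fun _ _ => zero_le_one) U
  have hφ1 : ∀ U, φ U ≤ 1 := fun U => Set.indicator_le_self' (fun _ _ => zero_le_one) U
  have hφinv : GaugeInvariant φ := fun u U => by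
    rw [hφ]
    by_cases hU' : U ∈ lo k
    · rw [Set.indicator_of_mem hU', Set.indicator_of_mem ((hloinv u U).2 hU')]
    · rw [Set.indicator_of_notMem hU', Set.indicator_of_notMem (fun h => hU' ((hloinv u U).1 h))]
  have hχm : Measurable χ₀ := hwm
  have hχinv : GaugeInvariant χ₀ := hwinv
  -- the two integrands: `φ`-cut (the row's) and `χB`-cut (the pins')
  set ρφ : Density S.P k G := fun U => φ U *
    Real.exp (-((towerOfAC 𝔎 X 𝔖).mainT k (Hist.triv S.P k) U) + (towerOfAC 𝔎 X 𝔖).Pint k (Hist.triv S.P k) U + c) with hρφ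
  set ρχ : Density S.P k G := fun U => χ₀ U *
    Real.exp (-((towerOfAC 𝔎 X 𝔖).mainT k (Hist.triv S.P k) U) + (towerOfAC 𝔎 X 𝔖).Pint k (Hist.triv S.P k) U + c) with hρχ
  obtain ⟨hρφm, hρφb, hρφinv⟩ := trivIntegrand_props 𝔎 X 𝔖 k hU hPm cP hPb hinv φ hφm hφ0 hφ1 hφinv c
  obtain ⟨hρχm, hρχb, hρχinv⟩ := trivIntegrand_props 𝔎 X 𝔖 k hU hPm cP hPb hinv χ₀ hχm hw0 hw1 hχinv c
  have hint : (fun U : GaugeField S.P k G => φ U *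
      Real.exp (-((towerOfAC 𝔎 X 𝔖).mainT k (Hist.triv S.P k) U) + (towerOfAC 𝔎 X 𝔖).Pint k (Hist.triv S.P k) U
        - (towerOfAC 𝔎 X 𝔖).Ecst k - (towerOfAC 𝔎 X 𝔖).Rm k)) = ρφ := by
    funext U; rw [hρφ]; dsimp only; congr 2; rw [hc]; ring
  -- the local chart identity AT THE `χB`-CUT integrand (supported in `O`)
  have hρχO : ∀ U, U ∉ O → ρχ U = 0 := fun U hU => by
    have h0 : χ₀ U = 0 := by
      by_contra h
      exact hU (hwO U h)
    rw [hρχ]; dsimp only; rw [h0, zero_mul]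
  have hT := hchart ρχ _ hρχm hρχb hρχinv hρχO
  -- monotonicity of the transport: `χB·e^{…} ≤ 𝟙_{lo k}·e^{…}` pointwise (`hdom`, `χB ≤ 1`)
  have hleρ : ∀ U, ρχ U ≤ ρφ U := fun U => by
    rw [hρχ, hρφ]; dsimp only
    refine mul_le_mul_of_nonneg_right ?_ (Real.exp_pos _).le
    by_cases h0 : χ₀ U = 0
    · rw [h0]; exact hφ0 _
    · rw [hφ, Set.indicator_of_mem (hwlo _ h0)]; exact hw1 _
  have hmonoT : rnTransport (X.av k).avg ρχ ≤ᵐ[fieldMeasure S.P (k + 1) G] rnTransport (X.av k).avg ρφ :=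
    Summit.QuantumFields.Balaban3D.Proofs.Transport48.rnTransport_mono_ae (X.av_ac k) hleρ
      (AveragingRT.integrable_of_abs_le hρχm _ hρχb) (AveragingRT.integrable_of_abs_le hρφm _ hρφb)
  have hg : 0 < S.gk k := gk_pos S k
  have hgk : (towerOfAC 𝔎 X 𝔖).g k = S.gk k := rfl
  unfold Fibre57LowOnAC
  rw [hint]
  refine Filter.EventuallyLE.trans ?_ (hT.symm.le.trans hmonoT)
  filter_upwards with V
  set m₁ : ℝ := (towerOfAC 𝔎 X 𝔖).mainT (k + 1) (Hist.triv S.P (k + 1)) V with hm₁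
  set Po : ℝ := (piecesAC 𝔎 X 𝔖 k).Pold (Hist.triv S.P (k + 1)) V with hPo
  by_cases hV : V ∈ lo (k + 1)
  · rw [Set.indicator_of_mem hV, one_mul, hσ, hdg, hgk, hstar, hZU V, hFl V]
    refine le_of_eq ?_
    -- the `χB`-cut integral in the pins' currency
    have hΨ : ∀ ω, J (V, ω) * ρχ (Φ (V, ω)) = Real.exp (-(q V ω)) * (Real.exp (-m₁ + Po + c) *
        (J (V, ω) * χ₀ (Φ (V, ω)) * Real.exp (-((towerOfAC 𝔎 X 𝔖).mainT k (Hist.triv S.P k) (Φ (V, ω)) - m₁)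
          + ((towerOfAC 𝔎 X 𝔖).Pint k (Hist.triv S.P k) (Φ (V, ω)) - Po) + q V ω))) := fun ω => by
      rw [hρχ]; dsimp only
      have e : Real.exp (-((towerOfAC 𝔎 X 𝔖).mainT k (Hist.triv S.P k) (Φ (V, ω))) + (towerOfAC 𝔎 X 𝔖).Pint k (Hist.triv S.P k) (Φ (V, ω)) + c)
          = Real.exp (-(q V ω)) * (Real.exp (-m₁ + Po + c) * Real.exp (-((towerOfAC 𝔎 X 𝔖).mainT k (Hist.triv S.P k) (Φ (V, ω)) - m₁)
            + ((towerOfAC 𝔎 X 𝔖).Pint k (Hist.triv S.P k) (Φ (V, ω)) - Po) + q V ω)) := by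
        rw [← Real.exp_add, ← Real.exp_add]; congr 1; ring
      rw [e]; ring
    simp_rw [hΨ]
    rw [integral_exp_neg_mul_eq (hqm V) (hZ V), integral_const_mul]
    conv_rhs => rw [← Real.exp_log (hZ V), ← Real.exp_log (hpos V hV), ← Real.exp_add, ← Real.exp_add, ← Real.exp_add]
    congr 1; rw [hc]; ring
  · rw [Set.indicator_of_notMem hV, zero_mul]
    exact mul_nonneg (Real.exp_pos _).le (integral_nonneg fun ω => mul_nonneg (hJ0 _)
      (by rw [hρχ]; dsimp only; exact mul_nonneg (hw0 _) (Real.exp_pos _).le))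

end Chart

/-! ## §2 The lower row for the block averaging with the printed average, abstract weight (`SU(N_c)`) -/

section BlockAvg

variable {L : ℕ} (𝔎 : LaneConsts L) {S : Scales L} {Nc : ℕ} [NeZero Nc]
  {Val : Type} [NormedAddCommGroup Val] [NormedSpace ℂ Val]
  (X : ExternalInputsAC S (Matrix.specialUnitaryGroup (Fin Nc) ℂ))
  (𝔖 : ∀ k, StepSeries S (Matrix.specialUnitaryGroup (Fin Nc) ℂ) Val (nblkOf S 𝔎.carrier k) k)

/-- ★★ **THE LOWER ROW FOR THE BLOCK AVERAGING WITH THE PRINTED AVERAGE, ABSTRACT SMALL-FIELD WEIGHT `w`** (every level, `SU(N_c)`): ✓`fibre57LowOnAC_of_blockAvgChart` VERBATIM with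
`χB_k(triv′)(Φ (V, U′)) ↦ w (Φ (V, U′))` in the pins `hFl`∕`hpos`, `w` measurable, in `[0,1]`, gauge invariant, supported in the (4)-window (`hwχ`, so `{w ≠ 0} ⊆ O_ε` on the size line by
✓`loopSmall_of_chiB_triv_ne_zero`) and in `lo k` (`hwlo`, the old `hdom`). [cite: Balaban1985UV3, (37) p.265 + (47) p.267 + (55)–(58) pp.269–270 + p.272 L32–33] -/
theorem fibre57LowOnAC_of_blockAvgChart_weight
    (lo : (k : ℕ) → Set (GaugeField S.P k (Matrix.specialUnitaryGroup (Fin Nc) ℂ))) (k : ℕ)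
    (hav : (X.av k).avg = avgFun (expMeanLogSU (n := Fin Nc)))
    {ε : ℝ} (hεS : 0 ≤ eps1Of S 𝔎.carrier k) (hwin : ((((S.P.d + 2) * S.P.L : ℕ) : ℝ) ^ 2 / 4) * eps1Of S 𝔎.carrier k < ε)
    (Φ : GaugeField S.P (k + 1) (Matrix.specialUnitaryGroup (Fin Nc) ℂ) × GaugeField S.P k (Matrix.specialUnitaryGroup (Fin Nc) ℂ) →
      GaugeField S.P k (Matrix.specialUnitaryGroup (Fin Nc) ℂ))
    (J : GaugeField S.P (k + 1) (Matrix.specialUnitaryGroup (Fin Nc) ℂ) × GaugeField S.P k (Matrix.specialUnitaryGroup (Fin Nc) ℂ) → ℝ≥0)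
    (T : Set (GaugeField S.P (k + 1) (Matrix.specialUnitaryGroup (Fin Nc) ℂ) × GaugeField S.P k (Matrix.specialUnitaryGroup (Fin Nc) ℂ)))
    (hΦ : Measurable Φ) (hJ : Measurable J) (hT : MeasurableSet T)
    (hmap : ((((fieldMeasure S.P (k + 1) (Matrix.specialUnitaryGroup (Fin Nc) ℂ)).prod
        (fieldMeasure S.P k (Matrix.specialUnitaryGroup (Fin Nc) ℂ))).restrict T).withDensity (fun z => (J z : ℝ≥0∞))).map Φ =
      (fieldMeasure S.P k (Matrix.specialUnitaryGroup (Fin Nc) ℂ)).restrict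
        {U : GaugeField S.P k (Matrix.specialUnitaryGroup (Fin Nc) ℂ) | ∀ c i, dist1 (loopHol U c i) < ε})
    (hfib : ∀ z ∈ T, avgFun (expMeanLogSU (n := Fin Nc)) (Φ z) = z.1) (N lσ dg : ℝ)
    (q : GaugeField S.P (k + 1) (Matrix.specialUnitaryGroup (Fin Nc) ℂ) → GaugeField S.P k (Matrix.specialUnitaryGroup (Fin Nc) ℂ) → ℝ)
    (hqm : ∀ V, Measurable (q V)) (hZ : ∀ V, 0 < partZ (fieldMeasure S.P k (Matrix.specialUnitaryGroup (Fin Nc) ℂ)) (q V))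
    (hU : Measurable (X.UkH k (Hist.triv S.P k))) (hPm : Measurable ((inputOfAC 𝔎 X 𝔖).Pint k (Hist.triv S.P k)))
    (cP : ℝ) (hPb : ∀ U, (inputOfAC 𝔎 X 𝔖).Pint k (Hist.triv S.P k) U ≤ cP)
    (hinv : GaugeInvariant (fun U : GaugeField S.P k (Matrix.specialUnitaryGroup (Fin Nc) ℂ) =>
      Real.exp (-((towerOfAC 𝔎 X 𝔖).mainT k (Hist.triv S.P k) U) + (towerOfAC 𝔎 X 𝔖).Pint k (Hist.triv S.P k) U)))
    (hlom : MeasurableSet (lo k))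
    (hloinv : ∀ (u : GaugeTransf S.P k (Matrix.specialUnitaryGroup (Fin Nc) ℂ)) (U : GaugeField S.P k (Matrix.specialUnitaryGroup (Fin Nc) ℂ)),
      gaugeAct u U ∈ lo k ↔ U ∈ lo k)
    (w : GaugeField S.P k (Matrix.specialUnitaryGroup (Fin Nc) ℂ) → ℝ) (hwm : Measurable w) (hw0 : ∀ U, 0 ≤ w U) (hw1 : ∀ U, w U ≤ 1) (hwinv : GaugeInvariant w)
    (hwχ : ∀ U : GaugeField S.P k (Matrix.specialUnitaryGroup (Fin Nc) ℂ),
      w U ≠ 0 → chiB 𝔎.carrier.M₁ (rcolOf S 𝔎.carrier) (eps1Of S 𝔎.carrier) k (Hist.triv S.P (k + 1)) U ≠ 0)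
    (hwlo : ∀ U : GaugeField S.P k (Matrix.specialUnitaryGroup (Fin Nc) ℂ), w U ≠ 0 → U ∈ lo k)
    (hσ : (piecesAC 𝔎 X 𝔖 k).logσ₀ = lσ) (hdg : (piecesAC 𝔎 X 𝔖 k).dg = dg) (hstar : (piecesAC 𝔎 X 𝔖 k).starB (Hist.triv S.P (k + 1)) = N)
    (hZU : ∀ V, (piecesAC 𝔎 X 𝔖 k).logZU (Hist.triv S.P (k + 1)) V =
      Real.log (partZ (fieldMeasure S.P k (Matrix.specialUnitaryGroup (Fin Nc) ℂ)) (q V)))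
    (hFl : ∀ V, (piecesAC 𝔎 X 𝔖 k).logFl (Hist.triv S.P (k + 1)) V =
      Real.log (∫ U', (Real.exp (-((lσ + dg * Real.log (S.gk k)) * N)) * T.indicator (fun z => (J z : ℝ)) (V, U')) * w (Φ (V, U')) *
              Real.exp (-((towerOfAC 𝔎 X 𝔖).mainT k (Hist.triv S.P k) (Φ (V, U')) - (towerOfAC 𝔎 X 𝔖).mainT (k + 1) (Hist.triv S.P (k + 1)) V)
                + ((towerOfAC 𝔎 X 𝔖).Pint k (Hist.triv S.P k) (Φ (V, U')) - (piecesAC 𝔎 X 𝔖 k).Pold (Hist.triv S.P (k + 1)) V) + q V U')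
            ∂(normalized (fieldMeasure S.P k (Matrix.specialUnitaryGroup (Fin Nc) ℂ)) (q V))))
    (hpos : ∀ V, V ∈ lo (k + 1) →
      0 < ∫ U', (Real.exp (-((lσ + dg * Real.log (S.gk k)) * N)) * T.indicator (fun z => (J z : ℝ)) (V, U')) * w (Φ (V, U')) *
              Real.exp (-((towerOfAC 𝔎 X 𝔖).mainT k (Hist.triv S.P k) (Φ (V, U')) - (towerOfAC 𝔎 X 𝔖).mainT (k + 1) (Hist.triv S.P (k + 1)) V)
                + ((towerOfAC 𝔎 X 𝔖).Pint k (Hist.triv S.P k) (Φ (V, U')) - (piecesAC 𝔎 X 𝔖 k).Pold (Hist.triv S.P (k + 1)) V) + q V U')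
            ∂(normalized (fieldMeasure S.P k (Matrix.specialUnitaryGroup (Fin Nc) ℂ)) (q V))) :
    Fibre57LowOnAC 𝔎 X 𝔖 lo k := by
  have hO : ∀ U : GaugeField S.P k (Matrix.specialUnitaryGroup (Fin Nc) ℂ), w U ≠ 0 →
        U ∈ {U : GaugeField S.P k (Matrix.specialUnitaryGroup (Fin Nc) ℂ) | ∀ c i, dist1 (loopHol U c i) < ε} := fun U hU =>
    loopSmall_of_chiB_triv_ne_zero 𝔎.carrier.M₁ (rcolOf S 𝔎.carrier) (eps1Of S 𝔎.carrier) k hεS hwin U (hwχ U hU)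
  have hfib' : ∀ z ∈ T, (X.av k).avg (Φ z) = z.1 := fun z hz => by rw [hav]; exact hfib z hz
  exact fibre57LowOnAC_of_localChart_weight 𝔎 X 𝔖 lo k (fieldMeasure S.P k (Matrix.specialUnitaryGroup (Fin Nc) ℂ)) Φ
    (fun z => Real.exp (-((lσ + dg * Real.log (S.gk k)) * N)) * T.indicator (fun z => (J z : ℝ)) z)
    (fun z => mul_nonneg (Real.exp_pos _).le (Set.indicator_nonneg (fun _ _ => NNReal.coe_nonneg _) _)) N lσ dg _ w hwm hw0 hw1 hwinv hO
    (fun ρ C hρm hρb _ hρO => localChart_of_hmap X k (fieldMeasure S.P k (Matrix.specialUnitaryGroup (Fin Nc) ℂ)) Φ J hΦ hJ hT hmap hfib' N lσ dg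
      ρ C hρm hρb hρO)
    q hqm hZ hU hPm cP hPb hinv hlom hloinv hwlo hσ hdg hstar hZU hFl hpos

/-! ## §3 The canonical weight `χB_k(triv′)·𝟙[lo k]` (print's χ_k-cut at `lo := loPrintAC`) -/

/-- **THE PRODUCT WEIGHT `w := χB_k(triv′)·𝟙[lo k]` HAS THE FIVE PROPERTIES**: measurable (`lo k` measurable), `0 ≤ w ≤ 1`, gauge invariant (`lo k` gauge invariant, ✓`chiB_gaugeAct`),
`w ≠ 0 ⇒ χB ≠ 0`, `w ≠ 0 ⇒ U ∈ lo k` — so §2 applies to it with `hwlo` DEFINITIONAL (at `lo := loPrintAC` this is print's χ_k of (47) times the (4)-window factor).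
[cite: Balaban1985UV3, (47) p.267 + (49) p.268] -/
theorem chiB_mul_indicator_props (lo : (k : ℕ) → Set (GaugeField S.P k (Matrix.specialUnitaryGroup (Fin Nc) ℂ))) (k : ℕ)
    (hlom : MeasurableSet (lo k))
    (hloinv : ∀ (u : GaugeTransf S.P k (Matrix.specialUnitaryGroup (Fin Nc) ℂ)) (U : GaugeField S.P k (Matrix.specialUnitaryGroup (Fin Nc) ℂ)),
      gaugeAct u U ∈ lo k ↔ U ∈ lo k) :
    Measurable (fun U : GaugeField S.P k (Matrix.specialUnitaryGroup (Fin Nc) ℂ) =>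
        chiB 𝔎.carrier.M₁ (rcolOf S 𝔎.carrier) (eps1Of S 𝔎.carrier) k (Hist.triv S.P (k + 1)) U * (lo k).indicator (fun _ => (1 : ℝ)) U) ∧
      (∀ U : GaugeField S.P k (Matrix.specialUnitaryGroup (Fin Nc) ℂ),
        0 ≤ chiB 𝔎.carrier.M₁ (rcolOf S 𝔎.carrier) (eps1Of S 𝔎.carrier) k (Hist.triv S.P (k + 1)) U * (lo k).indicator (fun _ => (1 : ℝ)) U) ∧
      (∀ U : GaugeField S.P k (Matrix.specialUnitaryGroup (Fin Nc) ℂ),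
        chiB 𝔎.carrier.M₁ (rcolOf S 𝔎.carrier) (eps1Of S 𝔎.carrier) k (Hist.triv S.P (k + 1)) U * (lo k).indicator (fun _ => (1 : ℝ)) U ≤ 1) ∧
      GaugeInvariant (fun U : GaugeField S.P k (Matrix.specialUnitaryGroup (Fin Nc) ℂ) =>
        chiB 𝔎.carrier.M₁ (rcolOf S 𝔎.carrier) (eps1Of S 𝔎.carrier) k (Hist.triv S.P (k + 1)) U * (lo k).indicator (fun _ => (1 : ℝ)) U) ∧
      (∀ U : GaugeField S.P k (Matrix.specialUnitaryGroup (Fin Nc) ℂ),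
        chiB 𝔎.carrier.M₁ (rcolOf S 𝔎.carrier) (eps1Of S 𝔎.carrier) k (Hist.triv S.P (k + 1)) U * (lo k).indicator (fun _ => (1 : ℝ)) U ≠ 0 →
          chiB 𝔎.carrier.M₁ (rcolOf S 𝔎.carrier) (eps1Of S 𝔎.carrier) k (Hist.triv S.P (k + 1)) U ≠ 0) ∧
      (∀ U : GaugeField S.P k (Matrix.specialUnitaryGroup (Fin Nc) ℂ),
        chiB 𝔎.carrier.M₁ (rcolOf S 𝔎.carrier) (eps1Of S 𝔎.carrier) k (Hist.triv S.P (k + 1)) U * (lo k).indicator (fun _ => (1 : ℝ)) U ≠ 0 → U ∈ lo k) := by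
  have hi0 : ∀ U : GaugeField S.P k (Matrix.specialUnitaryGroup (Fin Nc) ℂ), 0 ≤ (lo k).indicator (fun _ => (1 : ℝ)) U :=
    fun U => Set.indicator_nonneg (fun _ _ => zero_le_one) U
  have hi1 : ∀ U : GaugeField S.P k (Matrix.specialUnitaryGroup (Fin Nc) ℂ), (lo k).indicator (fun _ => (1 : ℝ)) U ≤ 1 :=
    fun U => Set.indicator_le_self' (fun _ _ => zero_le_one) U
  refine ⟨(measurable_chiB _ _ _ k _).mul (measurable_const.indicator hlom), fun U => mul_nonneg (chiB_nonneg _ _ _ k _ U) (hi0 U),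
    fun U => ?_, fun u U => ?_, fun U h => left_ne_zero_of_mul h, fun U h => ?_⟩
  · exact (mul_le_mul (chiB_le_one _ _ _ k _ U) (hi1 U) (hi0 U) zero_le_one).trans_eq (one_mul _)
  · show chiB _ _ _ k _ (gaugeAct u U) * (lo k).indicator (fun _ => (1 : ℝ)) (gaugeAct u U) = chiB _ _ _ k _ U * (lo k).indicator (fun _ => (1 : ℝ)) U
    rw [chiB_gaugeAct _ _ _ k _ u U]
    by_cases hU : U ∈ lo k
    · rw [Set.indicator_of_mem hU, Set.indicator_of_mem ((hloinv u U).2 hU)]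
    · rw [Set.indicator_of_notMem hU, Set.indicator_of_notMem (fun h => hU ((hloinv u U).1 h))]
  · by_contra hU
    exact h (by rw [Set.indicator_of_notMem hU, mul_zero])

end BlockAvg

end Summit.QuantumFields.YangMills.Theorems.PinnedStepTrivPins

end
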